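import Literature.Analysis.OperatorTheory.YangMillsMatrixModelAgmonCaccioppoli
import HarnessLib

/-!
# Agmon's `L²` exponential decay for eigenfunctions of Lüscher's matrix-model Hamiltonian:
# `∫ e^{2a⟨x⟩} f² < ∞` for every `a`, for every `C²` solution `f ∈ L²(ℝ⁹)` of `𝔥f = E f`

Topic `Literature/Analysis/OperatorTheory`; decay step (N5, base case) of the formalisation of the named fact
`LuscherHamiltonianEigenfunctions` (AL1), after `YangMillsMatrixModelAgmonWeights.lean` (weights `e^{φ(⟨x⟩)}`, weighted radial cut-offs)
and `YangMillsMatrixModelAgmonCaccioppoli.lean` (`energyForm_cutoff_mul_of_eq`, exhaustion by balls).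

The mechanism is Agmon's (Thm. 1.5 with the λ-condition (1.12) supplied by B. Simon's zero-point bound, the tree's PROVED
`integral_norm_sq_le_energyForm : ⅔∫‖x‖ψ² ≤ 𝔮(ψ)`): for the bounded, eventually constant weights `w_N = e^{φ_N(⟨x⟩)}`,
`φ_N(t) = a(N + (t−N)(1 − σ(t−N)))` (`σ` = Mathlib's `Real.smoothTransition`; `φ_N(t) = a t` for `t ≤ N`, `φ_N ≤ a t`, `φ_N ≤ a(N+1)`,
`|φ_N'| ≤ a(2 + C_σ)` uniformly in `N`) and the radial cut-off `χ_R`,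

  `⅔∫‖x‖χ²f² ≤ 𝔮(χf) = E∫χ²f² + ½∫‖∇χ‖²f² ≤ (E + L²)∫χ²f² + M₁e^{2a(N+1)}∫_{‖x‖≥R} f²`   (`χ = χ_R w_N`),

so `∫χ²f² ≤ K₀ + o_R(1)` with `K₀ = (1 + |E| + L²) e^{2a(1+R₀)} ‖f‖²₂`, `R₀ = 3(|E| + L² + 1)/2`, uniformly in `N`; letting `R → ∞` on the ball
`‖x‖ < S` with `N = S + 1` gives `∫_{‖x‖<S} e^{2a⟨x⟩} f² ≤ K₀` for every `S`, hence integrability (`integrable_exp_bracket_sq_mul_sq`).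

All proved; no definitions, no named facts.

## References
* [Agmon1982] S. Agmon, *Lectures on Exponential Decay…*, Princeton Math. Notes 29 (1982), (1.12), Thm. 1.5, Cor. 4.5.
* [SimonB1983DiscreteSpectrum] B. Simon, Ann. Phys. 146 (1983), §2 eq. (5) (the zero-point bound used as the λ-condition).
-/

noncomputable section

open MeasureTheory Filter Topology Function Metric Real
open scoped BigOperators ENNReal

namespace Literature.Analysis.OperatorTheory.YMMatrixModel

/-! ### 1. The saturating profiles `φ_N(t) = a (N + (t − N)(1 − σ(t − N)))` -/

section Clamp

/-- A uniform bound for the derivative of Mathlib's smooth transition: `|σ'(s)| ≤ C` for all `s`, and `σ' = 0` off `[0, 1]`.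
[cite: Agmon1982, §1] -/
theorem exists_deriv_smoothTransition_bound :
    ∃ C : ℝ, 0 ≤ C ∧ (∀ s : ℝ, |deriv smoothTransition s| ≤ C) ∧
      (∀ s : ℝ, s < 0 → deriv smoothTransition s = 0) ∧ (∀ s : ℝ, 1 < s → deriv smoothTransition s = 0) := by
  have hcd : Continuous (deriv smoothTransition) :=
    (smoothTransition.contDiff (n := 1)).continuous_deriv le_rfl
  have hneg : ∀ s : ℝ, s < 0 → deriv smoothTransition s = 0 := by
    intro s hs
    have hev : smoothTransition =ᶠ[𝓝 s] fun _ => (0 : ℝ) := by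
      filter_upwards [(isOpen_gt' (0 : ℝ)).mem_nhds hs] with t ht
      exact smoothTransition.zero_of_nonpos (le_of_lt ht)
    rw [hev.deriv_eq, deriv_const]
  have hpos : ∀ s : ℝ, 1 < s → deriv smoothTransition s = 0 := by
    intro s hs
    have hev : smoothTransition =ᶠ[𝓝 s] fun _ => (1 : ℝ) := by
      filter_upwards [(isOpen_lt' (1 : ℝ)).mem_nhds hs] with t ht
      exact smoothTransition.one_of_one_le (le_of_lt ht)
    rw [hev.deriv_eq, deriv_const]
  obtain ⟨C, hC⟩ := (isCompact_Icc (a := (0 : ℝ)) (b := 1)).exists_bound_of_continuousOn hcd.continuousOn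
  refine ⟨max C 0, le_max_right _ _, fun s => ?_, hneg, hpos⟩
  by_cases hs : s ∈ Set.Icc (0 : ℝ) 1
  · exact ((Real.norm_eq_abs _).symm.le.trans (hC s hs)).trans (le_max_left _ _)
  · rw [Set.mem_Icc, not_and_or, not_le, not_le] at hs
    rcases hs with h | h
    · rw [hneg s h, abs_zero]; exact le_max_right _ _
    · rw [hpos s h, abs_zero]; exact le_max_right _ _

/-- The saturating profile is `C²` (indeed smooth). [cite: Agmon1982, §1] -/
theorem contDiff_clamp (a N : ℝ) :
    ContDiff ℝ 2 fun t : ℝ => a * (N + (t - N) * (1 - smoothTransition (t - N))) := by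
  have hσ : ContDiff ℝ 2 fun t : ℝ => smoothTransition (t - N) :=
    (smoothTransition.contDiff (n := 2)).comp (contDiff_id.sub contDiff_const)
  exact contDiff_const.mul (contDiff_const.add ((contDiff_id.sub contDiff_const).mul (contDiff_const.sub hσ)))

/-- The derivative of the saturating profile. [cite: Agmon1982, §1] -/
theorem hasDerivAt_clamp (a N t : ℝ) :
    HasDerivAt (fun t : ℝ => a * (N + (t - N) * (1 - smoothTransition (t - N))))
      (a * ((1 - smoothTransition (t - N)) - (t - N) * deriv smoothTransition (t - N))) t := by
  have hσd : DifferentiableAt ℝ smoothTransition (t - N) :=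
    (smoothTransition.contDiff (n := 1)).differentiable (by norm_num) _
  have h1 : HasDerivAt (fun t : ℝ => smoothTransition (t - N)) (deriv smoothTransition (t - N)) t := by
    have := hσd.hasDerivAt.comp t ((hasDerivAt_id t).sub_const N)
    rw [mul_one] at this
    exact this
  have h2 : HasDerivAt (fun t : ℝ => (t - N) * (1 - smoothTransition (t - N)))
      (1 * (1 - smoothTransition (t - N)) + (t - N) * (0 - deriv smoothTransition (t - N))) t :=
    ((hasDerivAt_id t).sub_const N).mul ((hasDerivAt_const t 1).sub h1)
  have h3 := (h2.const_add N).const_mul a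
  exact h3.congr_deriv (by ring)

/-- **Uniform derivative bound** `|φ_N'| ≤ a(2 + C_σ)` (all `t`, all `N`). [cite: Agmon1982, §1 (1.10)] -/
theorem abs_deriv_clamp_le {a : ℝ} (ha : 0 ≤ a) {C : ℝ} (hC0 : 0 ≤ C) (hC : ∀ s : ℝ, |deriv smoothTransition s| ≤ C)
    (hneg : ∀ s : ℝ, s < 0 → deriv smoothTransition s = 0) (hpos : ∀ s : ℝ, 1 < s → deriv smoothTransition s = 0)
    (N t : ℝ) :
    |deriv (fun t : ℝ => a * (N + (t - N) * (1 - smoothTransition (t - N)))) t| ≤ a * (2 + C) := by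
  rw [(hasDerivAt_clamp a N t).deriv, abs_mul, abs_of_nonneg ha]
  apply mul_le_mul_of_nonneg_left _ ha
  set s := t - N with hs
  have hσ0 := smoothTransition.nonneg s
  have hσ1 := smoothTransition.le_one s
  have hA : |1 - smoothTransition s| ≤ 1 := by rw [abs_le]; constructor <;> linarith
  have hB : |s * deriv smoothTransition s| ≤ 1 + C := by
    by_cases h0 : s < 0
    · rw [hneg s h0, mul_zero, abs_zero]; linarith
    by_cases h1 : 1 < s
    · rw [hpos s h1, mul_zero, abs_zero]; linarith
    push Not at h0 h1
    rw [abs_mul]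
    have : |s| ≤ 1 := by rw [abs_le]; constructor <;> linarith
    calc |s| * |deriv smoothTransition s| ≤ 1 * C := mul_le_mul this (hC s) (abs_nonneg _) zero_le_one
      _ ≤ 1 + C := by linarith
  calc |1 - smoothTransition s - s * deriv smoothTransition s|
      ≤ |1 - smoothTransition s| + |s * deriv smoothTransition s| := abs_sub _ _
    _ ≤ 1 + (1 + C) := add_le_add hA hB
    _ = 2 + C := by ring

/-- `φ_N(t) = a t` for `t ≤ N`. [cite: Agmon1982, §1] -/
theorem clamp_eq_of_le {a N t : ℝ} (h : t ≤ N) : a * (N + (t - N) * (1 - smoothTransition (t - N))) = a * t := by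
  rw [smoothTransition.zero_of_nonpos (by linarith)]; ring

/-- `φ_N(t) ≤ a t` for all `t` (`a ≥ 0`). [cite: Agmon1982, §1] -/
theorem clamp_le_linear {a : ℝ} (ha : 0 ≤ a) (N t : ℝ) : a * (N + (t - N) * (1 - smoothTransition (t - N))) ≤ a * t := by
  apply mul_le_mul_of_nonneg_left _ ha
  set s := t - N with hs
  have hσ0 := smoothTransition.nonneg s
  have hσ1 := smoothTransition.le_one s
  by_cases h0 : s ≤ 0
  · rw [smoothTransition.zero_of_nonpos h0]; linarith
  · push Not at h0
    nlinarith

/-- `φ_N(t) ≤ a (N + 1)` for all `t` (`a ≥ 0`). [cite: Agmon1982, §1] -/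
theorem clamp_le_const {a : ℝ} (ha : 0 ≤ a) (N t : ℝ) :
    a * (N + (t - N) * (1 - smoothTransition (t - N))) ≤ a * (N + 1) := by
  apply mul_le_mul_of_nonneg_left _ ha
  set s := t - N with hs
  have hσ0 := smoothTransition.nonneg s
  have hσ1 := smoothTransition.le_one s
  by_cases h1 : 1 ≤ s
  · rw [smoothTransition.one_of_one_le h1]; linarith
  · push Not at h1
    by_cases h0 : s ≤ 0
    · rw [smoothTransition.zero_of_nonpos h0]; linarith
    · push Not at h0
      nlinarith

end Clamp

/-! ### 2. Agmon's bound: the `L²` eigenfunction decays faster than any exponential -/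

section Base

variable {f : ZM → ℝ} {E : ℝ}

/-- Tails of an integrable function over the complements of balls tend to zero. [cite: Agmon1982, Thm. 1.5 (proof)] -/
theorem tendsto_integral_compl_ball {g : ZM → ℝ} (hg : Integrable g) :
    Tendsto (fun n : ℕ => ∫ x in (ball (0 : ZM) ((n : ℝ) + 1))ᶜ, g x) atTop (𝓝 0) := by
  have hmono : Monotone fun n : ℕ => ball (0 : ZM) ((n : ℝ) + 1) := fun m n hmn =>
    ball_subset_ball (by exact_mod_cast Nat.succ_le_succ hmn)
  have hunion : (⋃ n : ℕ, ball (0 : ZM) ((n : ℝ) + 1)) = Set.univ := iUnion_ball_nat_succ 0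
  have h1 : Tendsto (fun n : ℕ => ∫ x in ball (0 : ZM) ((n : ℝ) + 1), g x) atTop (𝓝 (∫ x, g x)) := by
    have := tendsto_setIntegral_of_monotone (μ := volume) (fun n => measurableSet_ball) hmono
      (by rw [hunion]; exact hg.integrableOn)
    rwa [hunion, Measure.restrict_univ] at this
  have h2 : ∀ n : ℕ, ∫ x in (ball (0 : ZM) ((n : ℝ) + 1))ᶜ, g x = (∫ x, g x) - ∫ x in ball (0 : ZM) ((n : ℝ) + 1), g x := by
    intro n
    rw [← integral_add_compl (measurableSet_ball) hg]
    ring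
  simp_rw [h2]
  have := h1.const_sub (∫ x, g x)
  simpa using this

set_option maxHeartbeats 800000 in
/-- ★★ **Agmon's exponential `L²` bound for eigenfunctions of Lüscher's `𝔥`.**  For `f ∈ C²(ℝ⁹) ∩ L²` with `𝔥f = E f` pointwise and
every `a ≥ 0`, `e^{2a⟨x⟩} f²` is integrable (`⟨x⟩ = √(1+‖x‖²)`).  The λ-condition is B. Simon's zero-point bound `⅔∫‖x‖ψ² ≤ 𝔮(ψ)`.
[cite: Agmon1982, Thm. 1.5, Cor. 4.5] [cite: SimonB1983DiscreteSpectrum, §2 eq. (5)] -/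
theorem integrable_exp_bracket_sq_mul_sq (hf : ContDiff ℝ 2 f) (hf2 : Integrable fun x => f x ^ 2)
    (heq : ∀ x, hApply f x = E * f x) {a : ℝ} (ha : 0 ≤ a) :
    Integrable fun x : ZM => Real.exp (a * Real.sqrt (1 + ‖x‖ ^ 2)) ^ 2 * f x ^ 2 := by
  obtain ⟨C, hC0, hC, hneg, hpos⟩ := exists_deriv_smoothTransition_bound
  set L : ℝ := a * (2 + C) with hL_def
  have hL0 : 0 ≤ L := by positivity
  -- the equation in the form `𝔥 f = E f + 0`
  have heq' : ∀ x, hApply f x = E * f x + (fun _ => (0 : ℝ)) x := fun x => by simp [heq x]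
  -- constants
  set R₀ : ℝ := 3 * (|E| + L ^ 2 + 1) / 2 with hR₀_def
  have hR₀ : 0 < R₀ := by rw [hR₀_def]; positivity
  set K₀ : ℝ := (1 + |E| + L ^ 2) * Real.exp (a * (1 + R₀)) ^ 2 * ∫ x, f x ^ 2 with hK₀_def
  have hf2nn : 0 ≤ ∫ x, f x ^ 2 := integral_nonneg fun x => sq_nonneg _
  -- the target
  have hgc : Continuous fun x : ZM => Real.exp (a * Real.sqrt (1 + ‖x‖ ^ 2)) ^ 2 * f x ^ 2 :=
    ((contDiff_weight (φ := fun t => a * t) (contDiff_const.mul contDiff_id)).continuous.pow 2).mul (hf.continuous.pow 2)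
  refine (integrable_of_forall_setIntegral_ball_le hgc (fun x => by positivity) (K := K₀) fun S hS => ?_).1
  -- the saturating weight at level `N = S + 1`
  set N : ℝ := S + 1 with hN_def
  set φ : ℝ → ℝ := fun t => a * (N + (t - N) * (1 - smoothTransition (t - N))) with hφ_def
  have hφC : ContDiff ℝ 2 φ := contDiff_clamp a N
  have hφL : ∀ t, |deriv φ t| ≤ L := fun t => abs_deriv_clamp_le ha hC0 hC hneg hpos N t
  obtain ⟨M, hM0, hpack⟩ := weightedCutoff_package hφC hφL
  set w : ZM → ℝ := fun y => Real.exp (φ (Real.sqrt (1 + ‖y‖ ^ 2))) with hw_def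
  have hwc : Continuous w := (contDiff_weight hφC).continuous
  have hw_le_lin : ∀ x : ZM, w x ≤ Real.exp (a * Real.sqrt (1 + ‖x‖ ^ 2)) := fun x =>
    Real.exp_le_exp.mpr (clamp_le_linear ha N _)
  have hw_le_const : ∀ x : ZM, w x ≤ Real.exp (a * (N + 1)) := fun x => Real.exp_le_exp.mpr (clamp_le_const ha N _)
  have hw_eq : ∀ x : ZM, ‖x‖ < S → Real.exp (φ (Real.sqrt (1 + ‖x‖ ^ 2))) = Real.exp (a * Real.sqrt (1 + ‖x‖ ^ 2)) := by
    intro x hx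
    rw [hφ_def]
    simp only
    rw [clamp_eq_of_le]
    have := bracket_le_one_add_norm x
    rw [hN_def]; linarith
  -- Step A: the uniform bound `∫ χ_R² f² ≤ K₀ + M e^{2a(N+1)} ∫_{‖x‖ ≥ R} f²` for every `R ≥ 1`
  have stepA : ∀ R : ℝ, 1 ≤ R →
      ∫ x, ((radialCutoff R * w) x) ^ 2 * f x ^ 2 ≤ K₀ + M * Real.exp (a * (N + 1)) ^ 2 * ∫ x in (ball (0 : ZM) R)ᶜ, f x ^ 2 := by
    intro R hR
    obtain ⟨hχ, -, hχ0, hχle, hχgrad, hgradR, hgrad0⟩ := hpack R hR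
    set χ : ZM → ℝ := radialCutoff R * w with hχ_def
    have hχc := hχ.continuous
    have hψ : IsTestFn (χ * f) := hχ.mul_contDiff hf
    -- integrability of the compactly supported integrands
    have I1 : Integrable fun x => χ x ^ 2 * f x ^ 2 := by
      have := hψ.integrable_sq
      exact this.congr (Eventually.of_forall fun x => by simp [hχ_def, mul_pow])
    have Ix : Integrable fun x => ‖x‖ * (χ x ^ 2 * f x ^ 2) := by
      have := hψ.integrable_mul_sq continuous_norm
      exact this.congr (Eventually.of_forall fun x => by simp [hχ_def, mul_pow])
    have hgradχc : Continuous fun x => ‖gradient χ x‖ ^ 2 := by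
      have e : (fun x => ‖gradient χ x‖ ^ 2) = fun x => ∑ q, (pderiv q χ x) ^ 2 := by funext x; exact norm_gradient_sq χ x
      rw [e]; exact continuous_finsetSum _ fun q _ => (hχ.continuous_pderiv q).pow 2
    have hgradχs : HasCompactSupport fun x => ‖gradient χ x‖ ^ 2 := by
      refine HasCompactSupport.intro hχ.2 fun x hx => ?_
      simp [norm_gradient_sq, pderiv_eq_zero_of_notMem_tsupport hx]
    have I3 : Integrable fun x => ‖gradient χ x‖ ^ 2 * f x ^ 2 :=
      (hgradχc.mul (hf.continuous.pow 2)).integrable_of_hasCompactSupport hgradχs.mul_right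
    -- valley bound and localisation identity
    have hval : (2 / 3 : ℝ) * ∫ x, ‖x‖ * (χ x ^ 2 * f x ^ 2) ≤ energyForm (χ * f) := by
      have := integral_norm_sq_le_energyForm hψ
      refine le_trans (le_of_eq ?_) this
      congr 1
      exact integral_congr_ae (Eventually.of_forall fun x => by simp [hχ_def, mul_pow])
    have hid := energyForm_cutoff_mul_of_eq hχ hf continuous_const heq'
    simp only [mul_zero, integral_zero, add_zero] at hid
    -- `‖∇χ‖² ≤ 2 w² ‖∇χ_R‖² + 2L² χ²`, `∇χ_R = 0` on the ball, `‖∇χ_R‖² ≤ M`, `w ≤ e^{a(N+1)}`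
    set T : ℝ := M * Real.exp (a * (N + 1)) ^ 2 * ∫ x in (ball (0 : ZM) R)ᶜ, f x ^ 2 with hT_def
    have Icompl : Integrable fun x => Set.indicator (ball (0 : ZM) R)ᶜ (fun x => f x ^ 2) x :=
      (hf2.indicator measurableSet_ball.compl)
    have hgrad_bd : ∫ x, ‖gradient χ x‖ ^ 2 * f x ^ 2 ≤ 2 * T + 2 * L ^ 2 * ∫ x, χ x ^ 2 * f x ^ 2 := by
      have hpt : ∀ x, ‖gradient χ x‖ ^ 2 * f x ^ 2 ≤
          2 * (M * Real.exp (a * (N + 1)) ^ 2) * Set.indicator (ball (0 : ZM) R)ᶜ (fun x => f x ^ 2) x +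
            2 * L ^ 2 * (χ x ^ 2 * f x ^ 2) := by
        intro x
        have h1 := hχgrad x
        have hf0 : 0 ≤ f x ^ 2 := sq_nonneg _
        by_cases hx : ‖x‖ < R
        · have h0 : gradient (radialCutoff R) x = 0 := hgrad0 x hx
          rw [h0, norm_zero] at h1
          have hind : Set.indicator (ball (0 : ZM) R)ᶜ (fun x => f x ^ 2) x = 0 := by
            rw [Set.indicator_of_notMem]; simp [hx]
          rw [hind]
          nlinarith [mul_le_mul_of_nonneg_right h1 hf0]
        · have hind : Set.indicator (ball (0 : ZM) R)ᶜ (fun x => f x ^ 2) x = f x ^ 2 := by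
            rw [Set.indicator_of_mem]; simp [not_lt.mp hx]
          rw [hind]
          have h2 := hgradR x
          have h3 : w x ^ 2 ≤ Real.exp (a * (N + 1)) ^ 2 :=
            pow_le_pow_left₀ (Real.exp_pos _).le (hw_le_const x) 2
          have h4 : w x ^ 2 * ‖gradient (radialCutoff R) x‖ ^ 2 ≤ Real.exp (a * (N + 1)) ^ 2 * M :=
            mul_le_mul h3 h2 (sq_nonneg _) (sq_nonneg _)
          nlinarith [mul_le_mul_of_nonneg_right h1 hf0, mul_le_mul_of_nonneg_right h4 hf0]
      have Isum : Integrable fun x => 2 * (M * Real.exp (a * (N + 1)) ^ 2) * Set.indicator (ball (0 : ZM) R)ᶜ (fun x => f x ^ 2) x +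
          2 * L ^ 2 * (χ x ^ 2 * f x ^ 2) := (Icompl.const_mul _).add (I1.const_mul _)
      have := integral_mono I3 Isum hpt
      rw [integral_add (Icompl.const_mul _) (I1.const_mul _), integral_const_mul, integral_const_mul,
        integral_indicator measurableSet_ball.compl] at this
      rw [hT_def]
      linarith
    -- hence `∫ (⅔‖x‖ - E - L²) χ² f² ≤ T`
    have hkey : (2 / 3 : ℝ) * (∫ x, ‖x‖ * (χ x ^ 2 * f x ^ 2)) - (E + L ^ 2) * ∫ x, χ x ^ 2 * f x ^ 2 ≤ T := by
      nlinarith [hval, hid, hgrad_bd]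
    -- split at `R₀`: pointwise `χ²f² ≤ (⅔‖x‖ − E − L²)χ²f² + (1+|E|+L²)·1_{‖x‖<R₀}·χ²f²`
    have Iball : Integrable fun x => Set.indicator (ball (0 : ZM) R₀) (fun x => χ x ^ 2 * f x ^ 2) x :=
      I1.indicator measurableSet_ball
    have hsplit : ∫ x, χ x ^ 2 * f x ^ 2 ≤
        ((2 / 3 : ℝ) * (∫ x, ‖x‖ * (χ x ^ 2 * f x ^ 2)) - (E + L ^ 2) * ∫ x, χ x ^ 2 * f x ^ 2) +
          (1 + |E| + L ^ 2) * ∫ x, Set.indicator (ball (0 : ZM) R₀) (fun x => χ x ^ 2 * f x ^ 2) x := by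
      have hpt : ∀ x, χ x ^ 2 * f x ^ 2 ≤
          ((2 / 3 : ℝ) * (‖x‖ * (χ x ^ 2 * f x ^ 2)) - (E + L ^ 2) * (χ x ^ 2 * f x ^ 2)) +
            (1 + |E| + L ^ 2) * Set.indicator (ball (0 : ZM) R₀) (fun x => χ x ^ 2 * f x ^ 2) x := by
        intro x
        have hq : 0 ≤ χ x ^ 2 * f x ^ 2 := by positivity
        have hEabs := le_abs_self E
        by_cases hx : ‖x‖ < R₀
        · rw [Set.indicator_of_mem (by simpa using hx)]
          nlinarith [norm_nonneg x]
        · rw [Set.indicator_of_notMem (by simpa using hx), mul_zero, add_zero]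
          push Not at hx
          have : 1 ≤ (2 / 3 : ℝ) * ‖x‖ - (E + L ^ 2) := by
            rw [hR₀_def] at hx; nlinarith
          nlinarith
      have Idiff : Integrable fun x => (2 / 3 : ℝ) * (‖x‖ * (χ x ^ 2 * f x ^ 2)) - (E + L ^ 2) * (χ x ^ 2 * f x ^ 2) :=
        (Ix.const_mul _).sub (I1.const_mul _)
      have Isum : Integrable fun x => ((2 / 3 : ℝ) * (‖x‖ * (χ x ^ 2 * f x ^ 2)) - (E + L ^ 2) * (χ x ^ 2 * f x ^ 2)) +
          (1 + |E| + L ^ 2) * Set.indicator (ball (0 : ZM) R₀) (fun x => χ x ^ 2 * f x ^ 2) x := Idiff.add (Iball.const_mul _)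
      have := integral_mono I1 Isum hpt
      rw [integral_add Idiff (Iball.const_mul _),
        integral_sub (Ix.const_mul _) (I1.const_mul _), integral_const_mul, integral_const_mul, integral_const_mul] at this
      exact this
    -- the ball term: `χ² ≤ e^{2a⟨x⟩} ≤ e^{2a(1+R₀)}` on `‖x‖ < R₀`
    have hballterm : ∫ x, Set.indicator (ball (0 : ZM) R₀) (fun x => χ x ^ 2 * f x ^ 2) x ≤
        Real.exp (a * (1 + R₀)) ^ 2 * ∫ x, f x ^ 2 := by
      have hpt : ∀ x, Set.indicator (ball (0 : ZM) R₀) (fun x => χ x ^ 2 * f x ^ 2) x ≤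
          Real.exp (a * (1 + R₀)) ^ 2 * f x ^ 2 := by
        intro x
        by_cases hx : x ∈ ball (0 : ZM) R₀
        · rw [Set.indicator_of_mem hx]
          have hxn : ‖x‖ < R₀ := by simpa using hx
          have h1 : χ x ^ 2 ≤ w x ^ 2 := pow_le_pow_left₀ (hχ0 x) (hχle x) 2
          have h2 : w x ≤ Real.exp (a * (1 + R₀)) := by
            refine (hw_le_lin x).trans (Real.exp_le_exp.mpr (mul_le_mul_of_nonneg_left ?_ ha))
            have := bracket_le_one_add_norm x
            linarith
          have h3 : w x ^ 2 ≤ Real.exp (a * (1 + R₀)) ^ 2 := pow_le_pow_left₀ (Real.exp_pos _).le h2 2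
          exact mul_le_mul_of_nonneg_right (h1.trans h3) (sq_nonneg _)
        · rw [Set.indicator_of_notMem hx]; positivity
      have := integral_mono Iball (hf2.const_mul _) hpt
      rwa [integral_const_mul] at this
    have hEL : 0 ≤ 1 + |E| + L ^ 2 := by positivity
    calc ∫ x, χ x ^ 2 * f x ^ 2
        ≤ T + (1 + |E| + L ^ 2) * (Real.exp (a * (1 + R₀)) ^ 2 * ∫ x, f x ^ 2) := by
          nlinarith [hsplit, hkey, mul_le_mul_of_nonneg_left hballterm hEL]
      _ = K₀ + T := by rw [hK₀_def]; ring
      _ = K₀ + M * Real.exp (a * (N + 1)) ^ 2 * ∫ x in (ball (0 : ZM) R)ᶜ, f x ^ 2 := by rw [hT_def]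
  -- Step B: `R → ∞` on the fixed ball `‖x‖ < S`
  have htail := tendsto_integral_compl_ball hf2
  have hballS : ∀ n : ℕ, S ≤ (n : ℝ) + 1 →
      ∫ x in ball (0 : ZM) S, Real.exp (a * Real.sqrt (1 + ‖x‖ ^ 2)) ^ 2 * f x ^ 2 ≤
        K₀ + M * Real.exp (a * (N + 1)) ^ 2 * ∫ x in (ball (0 : ZM) ((n : ℝ) + 1))ᶜ, f x ^ 2 := by
    intro n hn
    have hR : (1 : ℝ) ≤ (n : ℝ) + 1 := by have : (0 : ℝ) ≤ n := n.cast_nonneg; linarith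
    obtain ⟨hχ, hχeq, hχ0, -, -, -, -⟩ := hpack _ hR
    have I1 : Integrable fun x => ((radialCutoff ((n : ℝ) + 1) * w) x) ^ 2 * f x ^ 2 := by
      have := (hχ.mul_contDiff hf).integrable_sq
      exact this.congr (Eventually.of_forall fun x => by simp [hw_def, mul_pow])
    refine le_trans ?_ (stepA _ hR)
    calc ∫ x in ball (0 : ZM) S, Real.exp (a * Real.sqrt (1 + ‖x‖ ^ 2)) ^ 2 * f x ^ 2
        = ∫ x in ball (0 : ZM) S, ((radialCutoff ((n : ℝ) + 1) * w) x) ^ 2 * f x ^ 2 := by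
          refine setIntegral_congr_fun measurableSet_ball fun x hx => ?_
          have hxS : ‖x‖ < S := by simpa using hx
          have hxn : ‖x‖ < (n : ℝ) + 1 := lt_of_lt_of_le hxS hn
          rw [hχeq x hxn, hw_eq x hxS]
      _ ≤ ∫ x, ((radialCutoff ((n : ℝ) + 1) * w) x) ^ 2 * f x ^ 2 :=
          setIntegral_le_integral I1 (ae_of_all _ fun x => by positivity)
  -- conclude by letting `n → ∞`
  refine le_of_forall_pos_lt_add fun ε hε => ?_
  have hMexp : 0 ≤ M * Real.exp (a * (N + 1)) ^ 2 := by positivity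
  have hev : ∀ᶠ n : ℕ in atTop, M * Real.exp (a * (N + 1)) ^ 2 * ∫ x in (ball (0 : ZM) ((n : ℝ) + 1))ᶜ, f x ^ 2 < ε := by
    have h1 : Tendsto (fun n : ℕ => M * Real.exp (a * (N + 1)) ^ 2 * ∫ x in (ball (0 : ZM) ((n : ℝ) + 1))ᶜ, f x ^ 2)
        atTop (𝓝 (M * Real.exp (a * (N + 1)) ^ 2 * 0)) := htail.const_mul _
    rw [mul_zero] at h1
    exact h1.eventually (gt_mem_nhds hε)
  have hev2 : ∀ᶠ n : ℕ in atTop, S ≤ (n : ℝ) + 1 := by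
    have := tendsto_natCast_atTop_atTop (R := ℝ)
    exact (this.eventually_ge_atTop S).mono fun n hn => by linarith
  obtain ⟨n, hn1, hn2⟩ := (hev.and hev2).exists
  linarith [hballS n hn2]

end Base

end Literature.Analysis.OperatorTheory.YMMatrixModel

end
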